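import Summits.Parity.GeneralizedHardyLittlewood.Theses.LiouvilleShiftedTables
import Summits.Parity.GeneralizedHardyLittlewood.Theorems.PairsToGHL.Negative.ShiftPairDictionary
import Literature.Barriers.Parity.SiegelZeroPrimePairs
import Literature.Barriers.Parity.SiegelZeroDichotomy

/-!
# Crux `PairsToGHL` (stmt-Parity-9389) in the illusory world: Siegel zeros of unbounded quality
# make the residual `PairsHL → GeneralizedHardyLittlewood` FAIL as soon as `PairsHL` holds

Negative lane of the crux `PairsToGHL` (cdisprove seat; shared by routes LiouvilleShiftedTables,
RoughSemiprimeRigidity, LiouvilleMAD, HullDial — same signature). Findings, all kernel-checked: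

* (context) `PairsToGHL` unfolds to `PairsHL → GeneralizedHardyLittlewood`, so `¬PairsToGHL ↔ PairsHL ∧
  ¬GeneralizedHardyLittlewood`: an unconditional kill needs a PROOF of Hardy–Littlewood pairs at every
  fixed shift AND a refutation of Green–Tao's Conjecture 1.2; neither is available, and the typed
  conjecture has no junk instance (audit and `not_pairsToGHL_iff` in the crux workfile
  `Cruxes/PairsToGHL/Disproof.lean`).
* `not_generalizedHardyLittlewood_of_unboundedSiegelZeros` — the thrice-forwarded seed of the closed
  cards `siegel-hardness-uniform-ghl` / `summit-implies-landau-siegel` / `siegel-negative-bridge`, now a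
  theorem: modulo the vendored Matomäki–Merikoski Theorem 1.3
  (`Literature.Barriers.Parity.MatomakiMerikoski2023_pairCorrelation`),
  `UnboundedSiegelZeros → ¬GeneralizedHardyLittlewood`. The typed conjecture is SHIFT-UNIFORM
  (`‖Ψ‖_N ≤ L` allows constants up to `L·N`), so it contains the system `(n, n + 2q)` at
  `N = q^{10}`, `L = 3`, `K = [-N, N]`, where an exceptional zero doubles the main term.
* the Green–Tao dictionary of the shift pair `(n, n + h)` it needs is the companion file
  `ShiftPairDictionary.lean` (`vonMangoldtSum_shiftPairSystem`, `archFactor_shiftPairSystem`,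
  `singularProduct_shiftPairSystem : ∏_p β_p = goldbachSingularSeries h`); here in addition
  `twinPrimeConst_mul_le_goldbachSingularSeries : C₂ · m/φ(m) ≤ 𝔖(m)` and the Matomäki–Merikoski
  correction factor `= +1` at `h = 2q` (`mm_correction_two_mul`).
* `pairsToGHL_false_of_unboundedSiegelZeros` — `MM → UnboundedSiegelZeros → PairsHL → ¬PairsToGHL`:
  in the only known consistent world where the summit conjunct is refutable, the residual is FALSE as
  soon as the routes deliver their own target `PairsHL` (fixed shifts are not obstructed by an
  exceptional zero); contrapositively `siegelZeros_bounded_of_pairsToGHL`: `PairsToGHL ∧ PairsHL`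
  bounds the quality of Siegel zeros at large conductors — any proof of the residual these routes can
  use is a Landau–Siegel-type theorem.
[folklore]
-/

namespace Summit.Parity.GeneralizedHardyLittlewood.Theorems.PairsToGHL.Negative

open Finset Filter MeasureTheory
open scoped Topology ArithmeticFunction.vonMangoldt
open Literature.NumberTheory.Sieve Literature.Barriers.Parity
open Summit.Parity.GeneralizedHardyLittlewood.Theses

noncomputable section

/-! ### `𝔖(h) ≥ C₂ · h/φ(h)` for even `h` -/

/-- `m/φ(m) = ∏_{p ∣ m} p/(p-1)` (from `φ(m) ∏_{p ∣ m} p = m ∏_{p ∣ m} (p - 1)`). [folklore] -/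
theorem self_div_totient_eq_prod {m : ℕ} (hm : m ≠ 0) :
    (m : ℝ) / (Nat.totient m : ℝ) = ∏ p ∈ m.primeFactors, ((p : ℝ) / ((p : ℝ) - 1)) := by
  have key := Nat.totient_mul_prod_primeFactors m
  have hφ : (0 : ℝ) < Nat.totient m := by
    exact_mod_cast Nat.totient_pos.mpr (Nat.pos_of_ne_zero hm)
  have hcast : (((∏ p ∈ m.primeFactors, (p - 1) : ℕ)) : ℝ) = ∏ p ∈ m.primeFactors, ((p : ℝ) - 1) := by
    rw [Nat.cast_prod]
    refine Finset.prod_congr rfl fun p hp => ?_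
    rw [Nat.cast_sub (Nat.prime_of_mem_primeFactors hp).one_le, Nat.cast_one]
  have keyR : (Nat.totient m : ℝ) * ∏ p ∈ m.primeFactors, (p : ℝ) =
      (m : ℝ) * ∏ p ∈ m.primeFactors, ((p : ℝ) - 1) := by
    have := congrArg (Nat.cast : ℕ → ℝ) key
    rw [Nat.cast_mul, Nat.cast_mul, hcast, Nat.cast_prod] at this
    exact this
  have hne : ∏ p ∈ m.primeFactors, ((p : ℝ) - 1) ≠ 0 := by
    refine Finset.prod_ne_zero_iff.mpr fun p hp => ?_
    have : (2 : ℝ) ≤ p := by exact_mod_cast (Nat.prime_of_mem_primeFactors hp).two_le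
    linarith
  rw [Finset.prod_div_distrib, div_eq_div_iff hφ.ne' hne]
  linarith [keyR]

/-- For even `m ≠ 0`: `C₂ · m/φ(m) ≤ 𝔖(m) = 2C₂ ∏_{p ∣ m, p > 2} (p-1)/(p-2)`, since
`m/φ(m) = 2 ∏_{p ∣ m, p > 2} p/(p-1)` and `p/(p-1) ≤ (p-1)/(p-2)`. [folklore] -/
theorem twinPrimeConst_mul_le_goldbachSingularSeries {m : ℕ} (hm : Even m) (h0 : m ≠ 0) :
    twinPrimeConst * ((m : ℝ) / (Nat.totient m : ℝ)) ≤ goldbachSingularSeries m := by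
  rw [goldbachSingularSeries_of_even m hm, self_div_totient_eq_prod h0]
  have h2 : 2 ∈ m.primeFactors :=
    Nat.mem_primeFactors.mpr ⟨Nat.prime_two, even_iff_two_dvd.mp hm, h0⟩
  rw [← Finset.mul_prod_erase _ _ h2]
  have herase : m.primeFactors.erase 2 = m.primeFactors.filter (2 < ·) := by
    ext p
    simp only [Finset.mem_erase, Finset.mem_filter, Nat.mem_primeFactors]
    constructor
    · rintro ⟨hne, hp, hdvd, hm0⟩
      exact ⟨⟨hp, hdvd, hm0⟩, lt_of_le_of_ne hp.two_le (Ne.symm hne)⟩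
    · rintro ⟨⟨hp, hdvd, hm0⟩, h2p⟩
      exact ⟨h2p.ne', hp, hdvd, hm0⟩
  have hβ2 : ((2 : ℕ) : ℝ) / (((2 : ℕ) : ℝ) - 1) = 2 := by norm_num
  rw [herase, hβ2]
  have hC : 0 < twinPrimeConst := twinPrimeConst_pos_holds
  have hle : ∏ p ∈ m.primeFactors.filter (2 < ·), ((p : ℝ) / ((p : ℝ) - 1)) ≤
      ∏ p ∈ m.primeFactors.filter (2 < ·), (((p : ℝ) - 1) / ((p : ℝ) - 2)) := by
    refine Finset.prod_le_prod (fun p hp => ?_) (fun p hp => ?_)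
    · have : (3 : ℝ) ≤ p := by exact_mod_cast (Finset.mem_filter.mp hp).2
      exact div_nonneg (by linarith) (by linarith)
    · have hp3 : (3 : ℝ) ≤ p := by exact_mod_cast (Finset.mem_filter.mp hp).2
      rw [div_le_div_iff₀ (by linarith) (by linarith)]
      nlinarith
  calc twinPrimeConst * (2 * ∏ p ∈ m.primeFactors.filter (2 < ·), ((p : ℝ) / ((p : ℝ) - 1)))
      = 2 * twinPrimeConst * ∏ p ∈ m.primeFactors.filter (2 < ·), ((p : ℝ) / ((p : ℝ) - 1)) := by
        ring
    _ ≤ 2 * twinPrimeConst * ∏ p ∈ m.primeFactors.filter (2 < ·), (((p : ℝ) - 1) / ((p : ℝ) - 2)) :=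
        mul_le_mul_of_nonneg_left hle (by linarith)

/-! ### The Matomäki–Merikoski correction factor at `h = 2q` -/

/-- At the shift `h = 2q` the correction factor of Matomäki–Merikoski's Theorem 1.3 equals `+1`, so
the main term DOUBLES: `φ(2^r) ∣ 2q` (`r = v₂(q)`), `2q/φ(2^r)` is even, and every prime factor of
`q' = q/2^r` divides `2q` (empty product). [cite: MatomakiMerikoski2023, Theorem 1.3] -/
theorem mm_correction_two_mul {q : ℕ} (hq : 0 < q) :
    (1 + if Nat.totient (2 ^ padicValNat 2 q) ∣ 2 * q then
        (-1 : ℝ) ^ (2 * q / Nat.totient (2 ^ padicValNat 2 q)) *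
          ∏ p ∈ (q / 2 ^ padicValNat 2 q).primeFactors.filter (fun p => ¬ p ∣ 2 * q),
            (-1 : ℝ) / ((p : ℝ) - 2)
      else 0) = 2 := by
  have _hq := hq
  set r := padicValNat 2 q with hr
  have ht : Nat.totient (2 ^ r) ∣ q := by
    rcases Nat.eq_zero_or_pos r with h0 | hpos
    · rw [h0, pow_zero, Nat.totient_one]; exact one_dvd q
    · rw [Nat.totient_prime_pow Nat.prime_two hpos]
      calc 2 ^ (r - 1) * (2 - 1) = 2 ^ (r - 1) := by norm_num
        _ ∣ 2 ^ r := pow_dvd_pow 2 (Nat.sub_le r 1)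
        _ ∣ q := pow_padicValNat_dvd
  have hdvd : Nat.totient (2 ^ r) ∣ 2 * q := ht.trans (dvd_mul_left q 2)
  have heven : Even (2 * q / Nat.totient (2 ^ r)) := by
    obtain ⟨m, hm⟩ := ht
    have htpos : 0 < Nat.totient (2 ^ r) := Nat.totient_pos.mpr (pow_pos two_pos r)
    refine ⟨m, ?_⟩
    rw [show 2 * q = Nat.totient (2 ^ r) * (m + m) by rw [hm]; ring, Nat.mul_div_cancel_left _ htpos]
  have hempty : (q / 2 ^ r).primeFactors.filter (fun p => ¬ p ∣ 2 * q) = ∅ := by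
    refine Finset.filter_eq_empty_iff.mpr fun p hp hndvd => hndvd ?_
    exact ((Nat.dvd_of_mem_primeFactors hp).trans
      (Nat.div_dvd_of_dvd pow_padicValNat_dvd)).trans (dvd_mul_left q 2)
  rw [if_pos hdvd, heven.neg_one_pow, hempty, Finset.prod_empty]
  norm_num

/-! ### The illusory world refutes the uniform clause of `GeneralizedHardyLittlewood` -/

/-- **Siegel zeros of unbounded quality refute `GeneralizedHardyLittlewood`** (Green–Tao Conj. 1.2
as typed: uniform over systems of size `‖Ψ‖_N ≤ L`, i.e. constant terms up to `L·N`), modulo the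
vendored theorem of Matomäki–Merikoski (`MatomakiMerikoski2023_pairCorrelation`, Theorem 1.3).
Take the system `(n, n + 2q)` at `N = X = q^{10}`, `L = 3`, `K = [-N, N]`: in the dictionary
(`vonMangoldtSum_shiftPairSystem`, `archFactor_shiftPairSystem`, `singularProduct_shiftPairSystem`)
the conjecture predicts `∑_{n ≤ N} Λ(n)Λ(n+2q) = N𝔖(2q) + o(N)`, whereas a real zero
`1 - 1/(η log q)` of a primitive quadratic `L(s, χ)` mod `q` gives `2N𝔖(2q)` up to
`K (h/φ(h)) N (e^{-√(10 log η)} + e^{-(log N)^{1/2}} + 10 log⁶η/η)` (`mm_correction_two_mul`); with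
`𝔖(2q) ≥ C₂ · 2q/φ(2q)` (`twinPrimeConst_mul_le_goldbachSingularSeries`) this is contradictory once
`η` and `q` are large, which `UnboundedSiegelZeros` supplies. Hence every PROOF of the summit
conjunct bounds the quality of Siegel zeros at large conductors (the seed forwarded by the triage of
cards `siegel-hardness-uniform-ghl`, `summit-implies-landau-siegel`, `siegel-negative-bridge`).
[cite: MatomakiMerikoski2023, Theorem 1.3] [cite: GreenTao2010, Conj. 1.2] -/
theorem not_generalizedHardyLittlewood_of_unboundedSiegelZeros
    (hMM : MatomakiMerikoski2023_pairCorrelation) (hU : UnboundedSiegelZeros) :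
    ¬ _root_.GeneralizedHardyLittlewood := by
  intro hG
  have hC₂ : 0 < twinPrimeConst := twinPrimeConst_pos_holds
  obtain ⟨K, hK, hMM'⟩ := hMM 1 le_rfl (1 / 10) (by norm_num) 1 one_pos
  set δ : ℝ := twinPrimeConst / (12 * K) with hδ
  have hδpos : 0 < δ := by positivity
  -- the conjecture at `d = 1`, `t = 2`, `L = 3`, `ε = C₂/4`
  obtain ⟨N₀, hN₀⟩ := hG 1 2 3 le_rfl (by norm_num) (twinPrimeConst / 4) (by positivity)
  -- thresholds: the three error terms of Matomäki–Merikoski are eventually `≤ δ`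
  have hT1 : ∀ᶠ η : ℝ in atTop, Real.exp (-1 * Real.sqrt (10 * Real.log η)) ≤ δ := by
    have h1 : Tendsto (fun η : ℝ => Real.exp (-1 * Real.sqrt (10 * Real.log η))) atTop (𝓝 0) := by
      refine Real.tendsto_exp_atBot.comp ?_
      have : Tendsto (fun η : ℝ => Real.sqrt (10 * Real.log η)) atTop atTop :=
        Real.tendsto_sqrt_atTop.comp (Real.tendsto_log_atTop.const_mul_atTop (by norm_num))
      simpa using this.const_mul_atTop_of_neg (by norm_num : (-1 : ℝ) < 0)
    exact (h1.eventually (gt_mem_nhds hδpos)).mono fun _ h => h.le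
  have hT2 : ∀ᶠ η : ℝ in atTop, 10 * Real.log η ^ (6 : ℕ) / η ≤ δ := by
    have h1 : Tendsto (fun η : ℝ => 10 * Real.log η ^ (6 : ℕ) / η) atTop (𝓝 0) := by
      have := (Real.tendsto_pow_log_div_mul_add_atTop 1 0 6 one_ne_zero).const_mul 10
      rw [mul_zero] at this
      refine this.congr' (Eventually.of_forall fun η => ?_)
      simp only [one_mul, add_zero]
      ring
    exact (h1.eventually (gt_mem_nhds hδpos)).mono fun _ h => h.le
  have hT3 : ∀ᶠ X : ℝ in atTop, Real.exp (-1 * Real.log X ^ (3 / 5 - 1 / 10 : ℝ)) ≤ δ := by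
    have h1 : Tendsto (fun X : ℝ => Real.exp (-1 * Real.log X ^ (3 / 5 - 1 / 10 : ℝ))) atTop
        (𝓝 0) := by
      refine Real.tendsto_exp_atBot.comp ?_
      have : Tendsto (fun X : ℝ => Real.log X ^ (3 / 5 - 1 / 10 : ℝ)) atTop atTop :=
        (tendsto_rpow_atTop (by norm_num)).comp Real.tendsto_log_atTop
      simpa using this.const_mul_atTop_of_neg (by norm_num : (-1 : ℝ) < 0)
    exact (h1.eventually (gt_mem_nhds hδpos)).mono fun _ h => h.le
  obtain ⟨η₁, hη₁⟩ := eventually_atTop.mp (hT1.and hT2)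
  obtain ⟨X₁, hX₁⟩ := eventually_atTop.mp hT3
  -- a Siegel zero of quality `η ≥ η₁` at a conductor `q ≥ max N₀ ⌈X₁⌉ 2`
  obtain ⟨q, inst, χ, η, hq, hη, hprim, hquad, hη10, hL⟩ := hU η₁ (max N₀ (max ⌈X₁⌉₊ 2))
  have hqN₀ : N₀ ≤ q := le_of_max_le_left hq
  have hqX₁ : ⌈X₁⌉₊ ≤ q := le_of_max_le_left (le_of_max_le_right hq)
  have hq2 : 2 ≤ q := le_of_max_le_right (le_of_max_le_right hq)
  have hqpos : 0 < q := by omega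
  set N : ℕ := q ^ 10 with hN
  have hNpos : 0 < N := pow_pos hqpos 10
  have hNr : (0 : ℝ) < N := by exact_mod_cast hNpos
  have hqN : q ≤ N := by
    calc q = q ^ 1 := (pow_one q).symm
      _ ≤ q ^ 10 := Nat.pow_le_pow_right hqpos (by norm_num)
  have h2qN : 2 * q ≤ N := by
    calc 2 * q ≤ q * q := Nat.mul_le_mul_right q hq2
      _ = q ^ 2 := (sq q).symm
      _ ≤ q ^ 10 := Nat.pow_le_pow_right hqpos (by norm_num)
  set X : ℝ := (q : ℝ) ^ (10 : ℝ) with hXdef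
  have hXN : X = (N : ℝ) := by
    rw [hXdef, hN, show (10 : ℝ) = ((10 : ℕ) : ℝ) by norm_num, Real.rpow_natCast, Nat.cast_pow]
  -- Matomäki–Merikoski at `h = 2q`, `V = 10`, `X = q^10`
  have hA : ((2 * q : ℕ) : ℝ) ≤ 1 * X := by
    rw [hXN, one_mul]; exact_mod_cast h2qN
  have hM := hMM' q hq2 χ hprim hquad η hη10 hL 10 X le_rfl hXdef (2 * q) (by omega) hA
  rw [mm_correction_two_mul hqpos, hXN, Nat.floor_natCast] at hM
  -- the conjecture for `(n, n + 2q)` on `[-N, N]`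
  have hnd : IsNondegenerateSystem (shiftPairSystem ((2 * q : ℕ) : ℤ)) :=
    isNondegenerateSystem_shiftPairSystem_iff.mpr (by exact_mod_cast (show 2 * q ≠ 0 by omega))
  have hGq := hN₀ N (hqN₀.trans hqN) (shiftPairSystem ((2 * q : ℕ) : ℤ)) hnd
    (affLinSize_shiftPairSystem_le hNpos h2qN) (realBox 1 N) (convex_Icc _ _) subset_rfl
  rw [vonMangoldtSum_shiftPairSystem, archFactor_shiftPairSystem,
    singularProduct_shiftPairSystem (even_two_mul q) (by omega), pow_one] at hGq
  -- bookkeeping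
  set S : ℝ := ∑ n ∈ Icc 1 N, Λ n * Λ (n + 2 * q) with hS
  set 𝔖 : ℝ := goldbachSingularSeries (2 * q) with h𝔖
  set ρ : ℝ := ((2 * q : ℕ) : ℝ) / (Nat.totient (2 * q) : ℝ) with hρ
  have hρ1 : 1 ≤ ρ := by
    have hφpos : (0 : ℝ) < (Nat.totient (2 * q) : ℝ) := by
      exact_mod_cast Nat.totient_pos.mpr (by omega)
    rw [hρ, le_div_iff₀ hφpos, one_mul]
    exact_mod_cast Nat.totient_le (2 * q)
  have hρ0 : 0 ≤ ρ := zero_le_one.trans hρ1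
  have h𝔖ρ : twinPrimeConst * ρ ≤ 𝔖 :=
    twinPrimeConst_mul_le_goldbachSingularSeries (even_two_mul q) (by omega)
  obtain ⟨hE1, hE2⟩ := hη₁ η hη
  have hX₁N : X₁ ≤ (N : ℝ) :=
    (Nat.le_ceil X₁).trans (by exact_mod_cast hqX₁.trans hqN)
  have hE3 := hX₁ (N : ℝ) hX₁N
  -- `N𝔖 ≤ |S - 2N𝔖| + |S - N𝔖| ≤ KρN·3δ + (C₂/4)N`
  have hKρN : 0 ≤ K * ρ * (N : ℝ) := mul_nonneg (mul_nonneg hK.le hρ0) hNr.le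
  have key : (N : ℝ) * 𝔖 ≤ K * ρ * N * (3 * δ) + twinPrimeConst / 4 * N := by
    have hM' : |S - (N : ℝ) * 𝔖 * 2| ≤ K * ρ * N * (3 * δ) :=
      hM.trans (mul_le_mul_of_nonneg_left (by linarith) hKρN)
    have ha := neg_abs_le (S - (N : ℝ) * 𝔖 * 2)
    have hb := le_abs_self (S - (N : ℝ) * 𝔖)
    linarith
  have h3δ : K * ρ * (N : ℝ) * (3 * δ) = (N : ℝ) * (twinPrimeConst * ρ / 4) := by
    rw [hδ]; field_simp; ring
  rw [h3δ] at key
  have hfin : 𝔖 ≤ twinPrimeConst * ρ / 4 + twinPrimeConst / 4 := by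
    have h' : (N : ℝ) * 𝔖 ≤ (N : ℝ) * (twinPrimeConst * ρ / 4 + twinPrimeConst / 4) := by linarith
    exact le_of_mul_le_mul_left h' hNr
  have hCρ : twinPrimeConst * 1 ≤ twinPrimeConst * ρ := mul_le_mul_of_nonneg_left hρ1 hC₂.le
  linarith

/-! ### Consequences for the crux `PairsToGHL` -/

/-- **The residual fails in the illusory world as soon as the routes succeed.** Modulo the vendored
Matomäki–Merikoski theorem: if Siegel zeros of unbounded quality exist (`UnboundedSiegelZeros`, the
standing hypothesis of Heath-Brown's dichotomy, consistent with every theorem in the tree) and the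
routes deliver their target `PairsHL` (fixed-shift Hardy–Littlewood pairs, which an exceptional zero
does NOT obstruct — it even implies them at exceptional scales, Matomäki–Merikoski Cor. 1.1), then
`PairsToGHL` is FALSE. Equivalently `PairsToGHL ∧ PairsHL ⊢ ¬UnboundedSiegelZeros`: any proof of the
residual usable by these routes is a Landau–Siegel-type theorem.
[cite: MatomakiMerikoski2023, Theorem 1.3 and Corollary 1.1] -/
theorem pairsToGHL_false_of_unboundedSiegelZeros (hMM : MatomakiMerikoski2023_pairCorrelation)
    (hU : UnboundedSiegelZeros) (hP : LiouvilleShiftedTables.PairsHL) :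
    ¬ LiouvilleShiftedTables.PairsToGHL := fun h =>
  not_generalizedHardyLittlewood_of_unboundedSiegelZeros hMM hU (h hP)

/-- **Any proof of the residual, joined with the routes' target, bounds Siegel zeros**: from
`PairsToGHL` and `PairsHL` (modulo Matomäki–Merikoski) there are `η₀`, `q₀` such that no primitive
quadratic character of conductor `q ≥ q₀` has a Siegel zero of quality `η ≥ η₀`
(`L(1 - 1/(η log q), χ) ≠ 0`). [cite: MatomakiMerikoski2023, Theorem 1.3] -/
theorem siegelZeros_bounded_of_pairsToGHL (hMM : MatomakiMerikoski2023_pairCorrelation)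
    (hG : LiouvilleShiftedTables.PairsToGHL) (hP : LiouvilleShiftedTables.PairsHL) :
    ∃ η₀ : ℝ, ∃ q₀ : ℕ, ∀ (q : ℕ) [NeZero q] (χ : DirichletCharacter ℂ q) (η : ℝ),
      q₀ ≤ q → IsSiegelZero χ η → η < η₀ := by
  have hnot : ¬ UnboundedSiegelZeros := fun hU =>
    pairsToGHL_false_of_unboundedSiegelZeros hMM hU hP hG
  unfold UnboundedSiegelZeros at hnot
  simp only [not_forall, not_exists, not_and] at hnot
  obtain ⟨η₀, q₀, hη⟩ := hnot
  refine ⟨η₀, q₀, fun q inst χ η hq hS => ?_⟩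
  by_contra hlt
  exact hη q inst χ η hq (not_lt.mp hlt) hS

end

end Summit.Parity.GeneralizedHardyLittlewood.Theorems.PairsToGHL.Negative
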